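import Summits.BirchSwinnertonDyer.BirchSwinnertonDyer.Theorems.ErratumRoadFiveKernelFromPrintB
import Summits.BirchSwinnertonDyer.BirchSwinnertonDyer.Theorems.ErratumRoadFiveIMCDivAtomsBRamFree
import Summits.BirchSwinnertonDyer.BirchSwinnertonDyer.Theorems.ErratumRoadFiveRamFreeTamagawaDescent
import HarnessLib

/-!
# Route `ErratumRoadFive` (K2, `p ≥ 5`), crux `Rest3NoWitnessBranchAtFive` (item stmt-BirchSwinnertonDyer-19703) —
# the T = 0 re-thread on the «RAM-FREE» erratum data: (TAM-q) for a NON-SPLIT `q` without `p ∤ ord_q(Δ_min)`, route p2's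
# pointwise open input and the `≥`-half of display (5.3) from the ram-free re-oriented shape

Cell `bsd-stepL` (run/shared/lean/pub/bsd-stepL/), seat `bsd-stepL-imc-p1` (prover g32, 2026-08-29); `--supports
stmt-BirchSwinnertonDyer-19703 --as helper`; Theses-free. Step K4 (kernel half, first file) of
`HOME/imc-p1/g26/RAMFREE-REKEY-PROPOSAL.md`, executed as a PARTIAL RESULT on the open crux 19703 (planner RULING 86 (c) governs
the ROUTE re-key, which is not touched: no item, statement or registry changes here).

## The point

Crux 19703 `Rest3NoWitnessBranchAtFive` is route p2's open input `P2OpenInputOnTreeAt W p` on the (ram) pairs with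
`E(ℚ_p)[p] = 0` and NO odd non-split multiplicative `q ≠ p` at which `E[p]` is RAMIFIED. Its NEW_A rows (census j319451:
7 548 pairs with `N < 5·10⁵`) DO carry an odd non-split multiplicative `q ≠ p` — with `p ∣ ord_q(Δ_min)`. The erratum road as
landed asks `¬ p ∣ ord_q(Δ_min)` of the datum's `q` in exactly two places: `ρ̄_{E,p}` onto (`surj_of_irr_of_ram`), and (TAM-q)
«`p ∤ c_w(E/K)` for `w ∣ q`» (`padicValNat_tamagawaProductSplit_eq_of_isErratumField`, `tamagawaDescentAt_of_isErratumField`).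
Both have ram-free substitutes: ANY (ram) prime gives `Surj`, and at a NON-SPLIT multiplicative `q` the Tamagawa numbers
`c_q(E)`, `c_w(E/K)` (`N(w) = q`, non-split stays non-split) and `c_q(E^{d_K})` lie in `{1, 2, 4}`, prime to the odd `p`
(g26's (U4) file `ErratumRoadFiveRamFreeTamagawaDescent`, p675810). The OPEN input is untouched: it is the re-oriented shape on
the ram-free data (`P2.IMCDivIntFrameAtErratumDataBRamFree`, file `ErratumRoadFiveIMCDivAtomsBRamFree`), which Road FF delivers
from F4♯‡ ([FW21 Thm. 4.41] as printed — no ramification clause) + F3♯‡ + Σ-data in the consumer file.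

## What this file proves (theorems only; no definition, no named fact, no `sorry`)

* §1 **`RamFree.padicValNat_tamagawaProductSplit_eq_of_isErratumField_nonsplit`** — (TAM-q) on an erratum field for an ODD
  NON-SPLIT multiplicative `q`, `p` odd, WITHOUT `p ∤ ord_q(Δ_min)`: `ord_p ∏_{w∣N⁺} c_w(E/K) = ord_p ∏_w c_w(E/K)`.
* §2 **`RamFree.imcLowerWaldspurgerOnTreeAt_of_frameBRamFree`** — route p2's POINTWISE open input at a ram-free erratum datum
  from the ram-free shape with value (imc24b's `imcLowerWaldspurgerOnTreeAt_of_imcDivIntFrameAtErratumDataB` VERBATIM with the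
  new binders).
* §3 **`RamFree.display53Lower_of_frameBRamFree`** — the `≥`-half (A≥) of Castella's display (5.3) at a ram-free datum.
The companion `ErratumRoadFiveKernelFromPrintBRamFree` continues: value from (VN_p), the main-conjecture half, the pair-level
open input, and the reduction «19703 ⟸ 19703‡».

HONEST FRAMING: CONDITIONAL on the ram-free re-oriented shape (OPEN; erratum (2.4) ⇐ [FW21, Thm. 4.41] + Hida descent,
PREPRINT) and on the cited PT/EP facts and GZK/modularity binders exactly as the landed B-kernel; nothing is booked; X11b stays
CONSTRUCTION-SHAPED; BSD is proved for no pair; the anticyclotomic main conjecture is asserted nowhere.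

References: [Castella2018] Thms. 2.3, 3.1–3.2, §5 (5.1)–(5.3) (arXiv:1704.06608 pp. 5, 9, 12); [Castella2018Erratum] Thm. 1.1,
(2.4) (pp. 1, 4); [JetchevSkinnerWan2017] §7.3.1, §7.4.1; [CastellaGrossiLeeSkinner2022] Thm. 5.1.1; [SilvermanATAEC1994]
IV.9.4; cell files `HOME/imc-p1/g26/RAMFREE-ROAD-imc-p1-g26.md`, `HOME/imc-p1/g26/RAMFREE-REKEY-PROPOSAL.md`.
-/

set_option autoImplicit false
set_option linter.dupNamespace false

noncomputable section
open scoped Classical Topology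
open Filter WeierstrassCurve NumberField IsDedekindDomain Field PowerSeries
open Literature.NumberTheory.EllipticCurves Literature.NumberTheory.EllipticCurves.GreenbergSelmer
open Literature.NumberTheory.EllipticCurves.ModularForms
open Literature.NumberTheory.EllipticCurves.Rank1Residual
open Literature.NumberTheory.EllipticCurves.Rank1Residual.Typed
open Literature.NumberTheory.EllipticCurves.Wuthrich2014
open Literature.NumberTheory.EllipticCurves.Castella2018
open Literature.NumberTheory.EllipticCurves.JetchevSkinnerWan2017
open Literature.NumberTheory.GaloisRepresentations
open Literature.NumberTheory.GaloisCohomology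
open Summit.BirchSwinnertonDyer.Rank1Residual Summit.BirchSwinnertonDyer.Rank1Residual.X11b
open Summit.BirchSwinnertonDyer.Rank1Residual.X11b.AcSelmer
open Summit.BirchSwinnertonDyer.Rank1Residual.X11b.Halves

/-! ### §1 (TAM-q) on an erratum field for a NON-SPLIT `q`, no ramification clause -/

namespace Summit.BirchSwinnertonDyer.BirchSwinnertonDyer.Theorems.RamFree

section Tamagawa

variable (W : WeierstrassCurve ℚ) [W.IsElliptic] [W.IsGloballyMinimal] (p : ℕ) [Fact p.Prime]
  (K : Type) [Field K] [NumberField K]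

/-- `ord_p` of a finite product of non-zero naturals is the sum of the `ord_p`. [folklore] -/
private theorem padicValNat_finsetProd_aux {ι : Type*} (s : Finset ι)
    (f : ι → ℕ) (hf : ∀ i ∈ s, f i ≠ 0) :
    padicValNat p (∏ i ∈ s, f i) = ∑ i ∈ s, padicValNat p (f i) := by
  classical
  induction s using Finset.induction_on with
  | empty => simp
  | insert a s ha ih =>
    rw [Finset.prod_insert ha, Finset.sum_insert ha,
      padicValNat.mul (hf a (Finset.mem_insert_self a s))
        (Finset.prod_ne_zero_iff.mpr fun i hi => hf i (Finset.mem_insert_of_mem hi)),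
      ih fun i hi => hf i (Finset.mem_insert_of_mem hi)]

omit [W.IsElliptic] [W.IsGloballyMinimal] [Fact p.Prime] in
/-- The datum's `q` is odd on an erratum field meeting [Cas20 §2.5]: `q ∣ d_K` (`IsErratumField`) and `d_K` is odd
(`Cas20Standing`). [folklore] -/
theorem two_ne_of_isErratumField_of_cas20Standing {q : ℕ} {N : ℕ} (hK : IsErratumField W K q)
    (hCas : Cas20Standing K p N) : q ≠ 2 := by
  rintro rfl
  have hodd : Odd (NumberField.discr K) := hCas.2.1
  have h2d : (2 : ℤ) ∣ NumberField.discr K := by exact_mod_cast hK.2.1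
  exact (Int.not_even_iff_odd.mpr hodd) (even_iff_two_dvd.mpr h2d)

/-- **(TAM-q) WITHOUT `p ∤ ord_q(Δ_min)`: `ord_p ∏_{w ∣ N⁺} c_w(E/K) = ord_p ∏_w c_w(E/K)`** for `W/ℚ` globally minimal
elliptic, an ODD prime `p`, an ODD NON-SPLIT multiplicative `q` and an erratum field `K` for `q` (every prime of `N_E`
other than `q` splits in `K`). The places of `K` off `N⁺` lie over good primes (`c = 1`) or over `q`; over `q` the fibre
sum `Σ_{w∣q} ord_p c_w(E_K) = ord_p c_q(E) + ord_p c_q(E^{d_K}) = 2·ord_p c_q(E)` (g26's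
`padicValNat_sum_fibre_eq_of_isErratumField_nonsplit`) vanishes because `c_q(E) ∈ {1, 2}` at a NON-SPLIT multiplicative
prime (`padicValNat_localTamagawaNumber_eq_zero_of_not_split`). The landed `padicValNat_tamagawaProductSplit_eq_of_isErratumField`
asks instead `p ∤ ord_q(Δ_min)` (Kodaira–Néron at a possibly SPLIT `q`); on the ram-free data that clause fails and this one
holds. [cite: Castella2018, §5 (arXiv:1704.06608 p. 12), from (5.2) to (5.3)]
[cite: SilvermanATAEC1994, IV.9.4 Step 2 (PDF p. 344)] -/
theorem padicValNat_tamagawaProductSplit_eq_of_isErratumField_nonsplit (hp2 : p ≠ 2) {q : ℕ} [Fact q.Prime]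
    (hq2 : q ≠ 2) (hmq : Mult W q) (hnsq : ¬ W.HasSplitMultiplicativeReductionAtPrime q)
    (hK : IsErratumField W K q) :
    padicValNat p (tamagawaProductSplit W K) = padicValNat p (W.baseChange K).tamagawaProduct := by
  have hpr : p.Prime := Fact.out
  haveI hEK : (W.baseChange K).IsElliptic := by rw [baseChange]; infer_instance
  have hd : (NumberField.discr K : ℚ) ≠ 0 := by exact_mod_cast NumberField.discr_ne_zero K
  haveI := W.isElliptic_quadraticTwist hd
  -- the local Tamagawa functions over `K` and over `ℚ`
  set cK : HeightOneSpectrum (𝓞 K) → ℕ := fun w =>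
    ((W.baseChange K).baseChange (w.adicCompletion K)).localTamagawaNumber
      (w.adicCompletionIntegers K) with hcK
  set cQ : HeightOneSpectrum (𝓞 ℚ) → ℕ := fun v =>
    (W.baseChange (v.adicCompletion ℚ)).localTamagawaNumber (v.adicCompletionIntegers ℚ) with hcQ
  set g : HeightOneSpectrum (𝓞 K) → ℕ := fun w =>
    if IsPlaceOverSplitConductorPrime W K w then cK w else 1 with hg
  have hcK0 : ∀ w, cK w ≠ 0 := fun w => (W.baseChange K).localTamagawaNumber_baseChange_ne_zero w
  have hg0 : ∀ w, g w ≠ 0 := fun w => by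
    by_cases h : IsPlaceOverSplitConductorPrime W K w
    · rw [hg]; simp only [h, if_true]; exact hcK0 w
    · rw [hg]; simp only [h, if_false]; exact one_ne_zero
  have hfinK : (Function.mulSupport cK).Finite :=
    (W.baseChange K).mulSupport_localTamagawaNumber_finite_holds
  set SK : Finset (HeightOneSpectrum (𝓞 K)) := hfinK.toFinset with hSK
  have hsubK : Function.mulSupport cK ⊆ ↑SK := by
    intro w hw
    exact hfinK.mem_toFinset.mpr hw
  have hsubg : Function.mulSupport g ⊆ ↑SK := by
    intro w hw
    apply hsubK
    rw [Function.mem_mulSupport] at hw ⊢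
    by_cases h : IsPlaceOverSplitConductorPrime W K w
    · rw [hg] at hw; simp only [h, if_true] at hw; exact hw
    · rw [hg] at hw; simp only [h, if_false] at hw; exact (hw rfl).elim
  -- both valuations as sums over `SK`
  have hK' : padicValNat p (W.baseChange K).tamagawaProduct = ∑ w ∈ SK, padicValNat p (cK w) := by
    rw [show (W.baseChange K).tamagawaProduct = ∏ᶠ w, cK w from rfl,
      finprod_eq_prod_of_mulSupport_subset cK hsubK]
    exact padicValNat_finsetProd_aux p SK cK fun w _ => hcK0 w
  have hg' : padicValNat p (tamagawaProductSplit W K) = ∑ w ∈ SK, padicValNat p (g w) := by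
    rw [show tamagawaProductSplit W K = ∏ᶠ w, g w from rfl,
      finprod_eq_prod_of_mulSupport_subset g hsubg]
    exact padicValNat_finsetProd_aux p SK g fun w _ => hg0 w
  rw [hK', hg']
  refine Finset.sum_congr rfl fun w _ => ?_
  by_cases hcond : IsPlaceOverSplitConductorPrime W K w
  · rw [hg]; simp only [hcond, if_true]
  -- off `N⁺`: the factor `c_w(E_K)` is a `p`-unit
  rw [hg]; simp only [hcond, if_false, padicValNat_one_right]
  symm
  set v : HeightOneSpectrum (𝓞 ℚ) := w.under (𝓞 ℚ) with hvdef
  set ℓ : ℕ := (Rat.HeightOneSpectrum.primesEquiv v : ℕ) with hℓdef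
  haveI hℓ : Fact ℓ.Prime := ⟨(Rat.HeightOneSpectrum.primesEquiv v).2⟩
  have hvℓ : (Rat.HeightOneSpectrum.primesEquiv v : ℕ) = ℓ := rfl
  -- the fibre identity over `v` on an erratum field for a NON-SPLIT `q` (g26's (U4) file; no `hvq`)
  have hfib := padicValNat_sum_fibre_eq_of_isErratumField_nonsplit W p hp2 K hq2 hmq hnsq hK
    (W.quadraticTwist (NumberField.discr K : ℚ)) (C := (1 : VariableChange ℚ)) (one_smul _ _) v
  -- `ord_p c_ℓ(E) = 0`
  have hQ0 : padicValNat p (cQ v) = 0 := by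
    by_cases hℓN : ℓ ∣ W.conductorNorm ℤ
    · -- `ℓ ∣ N` and `w ∉ N⁺`, so `ℓ` does not split: `ℓ = q`, NON-SPLIT multiplicative, `c_q(E) ∈ {1, 2}`
      have hns : ¬ SplitsIn K ℓ := fun hs => hcond ⟨hs, hℓN⟩
      have hℓq : ℓ = q := by
        by_contra hne
        exact hns (hK.2.2.1 ℓ hℓ.out hℓN hne)
      have hmv : W.HasMultiplicativeReductionAt v :=
        (hasMultiplicativeReductionAtPrime_primesEquiv_iff_holds W v ℓ hvℓ).mp (hℓq ▸ hmq)
      have hnsv : ¬ W.HasSplitMultiplicativeReductionAt v :=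
        not_hasSplitMultiplicativeReductionAt_of_primesEquiv_eq W v (q := q) (hvℓ.trans hℓq) hnsq
      exact padicValNat_localTamagawaNumber_eq_zero_of_not_split W v hp2 hmv hnsv
    · -- `ℓ ∤ N`: good reduction, `c_ℓ(E) = 1`
      have hgood : W.HasGoodReductionAt v :=
        (hasGoodReductionAtPrime_primesEquiv_iff_holds W v ℓ hvℓ).mp
          (by
            by_contra hbad'
            exact hℓN ((W.dvd_conductorNorm_iff_not_hasGoodReductionAtPrime ℓ).mpr hbad'))
      have h1 : cQ v = 1 := W.localTamagawaNumber_eq_one_of_hasGoodReductionAt_holds v hgood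
      rw [h1, padicValNat_one_right]
  -- hence the fibre sum over `v` vanishes, and so does each of its terms, in particular at `w`
  have hsum0 : (∑ w' ∈ (HeightOneSpectrum.finite_setOf_under_eq_of_numberField (K := K) v).toFinset,
      padicValNat p (cK w')) = 0 := by
    rw [hfib.1, hfib.2, hQ0]
  have hwmem : w ∈ (HeightOneSpectrum.finite_setOf_under_eq_of_numberField (K := K) v).toFinset := by
    rw [Set.Finite.mem_toFinset]
    exact hvdef.symm
  exact Finset.sum_eq_zero_iff.mp hsum0 w hwmem

end Tamagawa

/-! ### §2 Route p2's pointwise open input at a ram-free erratum datum from the ram-free shape -/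

section Pointwise

variable {W : WeierstrassCurve ℚ} [W.IsElliptic] [W.IsGloballyMinimal] {p : ℕ} [Fact p.Prime]
  {K : Type} [Field K] [NumberField K]

/-- **Route p2's POINTWISE open input `(IMC≥∘BDP)ᵗ` AT A RAM-FREE ERRATUM DATUM from the RAM-FREE re-oriented shape
with value.** Same data and conclusion as imc24b's `imcLowerWaldspurgerOnTreeAt_of_imcDivIntFrameAtErratumDataB`, with
the pair binders `5 ≤ p`, `Mult W p`, `Surj W p`, `E(ℚ_p)[p] = 0` in place of `ErratumHypotheses W p` and NO
`¬ p ∣ ord_q(Δ_min)`: for `r_an(E) = 1`, a non-split multiplicative `q ≠ p`, an erratum field `K` for `q` with [Cas20 §2.5]'s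
standing hypotheses, a Manin-good datum `Dt`, a Heegner point `P` of infinite order read through ANY complex embedding `ιK`,
anticyclotomic `(κ, γ)` and a degree-one `𝔭 ∋ p`: `IMCLowerWaldspurgerOnTreeAt p κ 𝔭 γ (embAt K p 𝔭) P`. Proof = the
B-proof VERBATIM (CTL₀ at `𝔭` needs only `Mult W p`, `Irr W p`; the other prime `𝔮 = 𝔭_{ι′}`, `P' = τ_* P`, frame at
`(ι′, 𝔮)`, X-slot `𝔭`, (T0) log-symmetry). CONDITIONAL on the ram-free shape (OPEN).
[cite: Castella2018, Thms. 2.3, 3.1, 3.2 and §5 (arXiv:1704.06608 pp. 5, 9, 12)] [cite: Castella2018Erratum, (2.4) (p. 4)]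
[cite: CastellaGrossiLeeSkinner2022, Thm. 5.1.1] -/
theorem imcLowerWaldspurgerOnTreeAt_of_frameBRamFree
    (hGZK : rank_eq_analyticRank_of_analyticRank_le_one) (hnf : exists_isNewformOf)
    (hPT : ∀ (K : Type) [Field K] [NumberField K], poitouTate_sum_localTatePairing_eq_zero K)
    (hEP : ∀ (K : Type) [Field K] [NumberField K] (v : HeightOneSpectrum (𝓞 K)),
      localEulerPoincareCharacteristic (v.adicCompletion K))
    (ι : PadicAlgCl p ≃+* ℂ) (hD : P2.IMCDivIntFrameAtErratumDataBRamFree W p)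
    [NeZero (W.conductorNorm ℤ)] {q : ℕ} [Fact q.Prime]
    (Dt : ModularParametrizationData W (W.conductorNorm ℤ))
    (H : HeegnerDatum (W.conductorNorm ℤ) (NumberField.discr K)) (ιK : K →+* ℂ)
    {P : (W.baseChange K).toAffine.Point} (hp5 : 5 ≤ p) (hmult : Mult W p) (hsurj : Surj W p)
    (htors : ∀ P₀ : (W.baseChange ℚ_[p]).toAffine.Point, p • P₀ = 0 → P₀ = 0) (hr : W.analyticRank = 1)
    (hqp : q ≠ p) (hmq : Mult W q) (hns : ¬ W.HasSplitMultiplicativeReductionAtPrime q)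
    (hK : IsErratumField W K q) (hCas : Cas20Standing K p (W.conductorNorm ℤ / p))
    (hP : WeierstrassCurve.Affine.Point.map ιK.toRatAlgHom P = heegnerPointComplex Dt H)
    (hc : ¬ (p : ℤ) ∣ Dt.c) (hinf : ¬ IsOfFinAddOrder P)
    {κ : ZpExtension K p} (hκ : κ.IsAnticyclotomic) (γ : Field.absoluteGaloisGroup K)
    [Fact (κ.IsTopGenerator γ)]
    (𝔭 : HeightOneSpectrum (𝓞 K)) (h𝔭 : ((p : ℕ) : 𝓞 K) ∈ 𝔭.asIdeal)
    (he : 𝔭.asIdeal.ramificationIdx (𝓞 ℚ) = 1) (hf : 𝔭.asIdeal.inertiaDeg (𝓞 ℚ) = 1) :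
    IMCLowerWaldspurgerOnTreeAt p κ 𝔭 γ (embAt K p 𝔭 h𝔭 he hf) P := by
  have hirr : Irr W p := hasIrreducibleModPGaloisRep_of_hasSurjectiveModNGaloisRep W p hsurj
  -- the one-sided control at the datum supplies CTL₀ at the X-slot `𝔭`
  obtain ⟨n, hn, -⟩ := controlUpperOnTreeAt_of_isErratumField hGZK hnf hPT hEP hr hmult hirr hqp
    hK hinf hκ γ 𝔭 h𝔭 he hf
  obtain ⟨w₀⟩ := (inferInstance : Nonempty (InfinitePlace K))
  have hp2 : p ≠ 2 := by omega
  -- `rank_ℤ E(K) = 1` on the erratum field (Gross–Zagier–Kolyvagin over `ℚ`)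
  have hrk : (W.baseChange K).mordellWeilRank = 1 :=
    (IsErratumField.mordellWeilRank_eq_one_and_shaFinite W hGZK hnf hr hK).1
  -- the datum's complex embedding is `w₀.embedding ∘ τ` for some `τ ∈ Gal(K/ℚ)`, `τ² = 1`
  haveI : IsGalois ℚ K := by
    haveI : Algebra.IsQuadraticExtension ℚ K := ⟨hK.1.1⟩
    infer_instance
  obtain ⟨σ, hσ⟩ := ComplexEmbedding.exists_comp_symm_eq_of_comp_eq (k := ℚ) w₀.embedding ιK
    (by ext x; simp)
  set τ : K →+* K := ((σ.symm : K ≃ₐ[ℚ] K) : K →+* K) with hτdef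
  have hτ : ∀ x, τ (τ x) = x := by
    intro x
    have hcard : Nat.card (K ≃ₐ[ℚ] K) = 2 := by rw [IsGalois.card_aut_eq_finrank, hK.1.1]
    have hsq : σ.symm * σ.symm = 1 := by
      have h := pow_card_eq_one' (G := K ≃ₐ[ℚ] K) (x := σ.symm)
      rwa [hcard, pow_two] at h
    have := congrArg (fun g : K ≃ₐ[ℚ] K ↦ g x) hsq
    simpa [hτdef, AlgEquiv.mul_apply] using this
  -- the Galois conjugate `P' = τ_* P` is the Heegner point read through `w₀.embedding`
  set P' := WeierstrassCurve.Affine.Point.map τ.toRatAlgHom P with hP'def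
  have hP' : WeierstrassCurve.Affine.Point.map w₀.embedding.toRatAlgHom P' =
      heegnerPointComplex Dt H := by
    rw [hP'def, WeierstrassCurve.Affine.Point.map_map]
    have hcomp : w₀.embedding.toRatAlgHom.comp τ.toRatAlgHom = ιK.toRatAlgHom := by
      apply AlgHom.ext
      intro x
      have := RingHom.congr_fun hσ x
      simpa [hτdef] using this
    rw [hcomp]
    exact hP
  have hinf' : ¬ IsOfFinAddOrder P' := fun h ↦ hinf
    ((WeierstrassCurve.Affine.Point.map_injective (f := τ.toRatAlgHom)).isOfFinAddOrder_iff.mp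
      (by simpa [hP'def] using h))
  have hlogP : ∀ e : K →+* ℚ_[p], X11b.padicLogOrd W p e P' = X11b.padicLogOrd W p e P := fun e ↦
    R1.padicLogOrd_map_eq_of_rank_one W p e P hp2 τ hτ hrk hinf
  -- the OTHER prime `𝔮 ≠ 𝔭` above the split `p`, of degree one, and THE embedding at `𝔮`
  have hsplit : SplitsIn K p := hK.splitsIn_of_mult hmult (Ne.symm hqp)
  obtain ⟨-, 𝔮, -, h𝔮ne, h𝔮p, -⟩ := LocalIndexTransport.exists_conj_prime_of_splitsIn K p hK.1.1 hsplit h𝔭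
  obtain ⟨he', hf'⟩ := degreeOne_of_splitsIn hK.1.1 hsplit h𝔮p
  have hemb' : ∀ k : 𝓞 K, k ∈ 𝔮.asIdeal ↔ ‖embAt K p 𝔮 h𝔮p he' hf' (k : K)‖ < 1 :=
    mem_asIdeal_iff_norm_embAt_lt_one 𝔮 h𝔮p he' hf'
  -- (T0): the logarithm order at `𝔮` equals the one at `𝔭`
  have hlog𝔮 : X11b.padicLogOrd W p (embAt K p 𝔮 h𝔮p he' hf') P =
      X11b.padicLogOrd W p (embAt K p 𝔭 h𝔭 he hf) P :=
    R1.padicLogOrd_eq_of_isErratumField W p hGZK hnf hr hp2 hK hinf _ _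
  -- `𝔮` is induced by `ι` or by `ι ∘ conj`; the ram-free shape with frame at `(ι′, 𝔮)` and X-slot `𝔭`
  have key : ∀ ι' : PadicAlgCl p ≃+* ℂ, 𝔮 = primeOfEmbeddingDatum p ι' w₀.embedding →
      IMCLowerWaldspurgerOnTreeAt p κ 𝔭 γ (embAt K p 𝔭 h𝔭 he hf) P := by
    intro ι' h𝔮eq
    have hne : 𝔭 ≠ primeOfEmbeddingDatum p ι' w₀.embedding := fun h ↦ h𝔮ne (h𝔮eq.trans h.symm)
    have hemb'' : ∀ k : 𝓞 K, k ∈ (primeOfEmbeddingDatum p ι' w₀.embedding).asIdeal ↔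
        ‖embAt K p 𝔮 h𝔮p he' hf' (k : K)‖ < 1 := fun k ↦ by rw [← h𝔮eq]; exact hemb' k
    obtain ⟨ΩK, Ωp, Q, -, -, -, ⟨u, hu, hval⟩, h3At⟩ :=
      hD q K Dt H w₀ P' hp5 hmult hsurj htors hr hqp hmq hns hK hCas hP' hc hinf' κ hκ γ ι' _ hemb'' 𝔭
        h𝔭 hne
    have h1 : IMCLowerWaldspurgerOnTreeAt p κ 𝔭 γ (embAt K p 𝔮 h𝔮p he' hf') P' :=
      R1.imcLowerWaldspurgerOnTreeAt_of_intValue_of_intDvd hn h3At (le_of_eq hu) (W.LFunction p) hval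
    have h2 : IMCLowerWaldspurgerOnTreeAt p κ 𝔭 γ (embAt K p 𝔮 h𝔮p he' hf') P :=
      imcLowerWaldspurgerOnTreeAt_of_padicLogOrd_eq W p _ (hlogP _) h1
    exact imcLowerWaldspurgerOnTreeAt_of_padicLogOrd_eq_emb W p hlog𝔮 h2
  rcases eq_primeOfEmbeddingDatum_or_eq_trans_starRingAut p ι hK.1 w₀ h𝔮p with h | h
  · exact key ι h
  · exact key _ h

/-! ### §3 The `≥`-half of Castella's display (5.3) at a ram-free erratum datum -/

/-- **The `≥`-HALF of Castella's display (5.3) — (A≥) — AT A RAM-FREE ERRATUM DATUM from the RAM-FREE shape, `p ≥ 5`:**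
`2·ord_p[E(K):ℤP] − ord_p ∏_w c_w(E/K) ≤ ord_p #Ш(E/K)[p^∞]`. imc24b's `display53Lower_of_imcDivIntFrameAtErratumDataB`
VERBATIM except that (TAM-q) is §1's NON-SPLIT version (no `¬ p ∣ ord_q(Δ_min)`); CTL at one anticyclotomic `(κ, γ, 𝔭)`
(`controlUpperOnTreeAt_of_isErratumField`, `two_mul_index_le_of_onTreeUpperLinks`) is unchanged.
CONDITIONAL on the ram-free shape (OPEN). [cite: Castella2018, §5 (5.1)–(5.3) (arXiv:1704.06608 p. 12)]
[cite: JetchevSkinnerWan2017, §7.4.1 (eq:shalowerK-1) (arXiv:1512.06894 p. 30)] -/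
theorem display53Lower_of_frameBRamFree
    (hGZK : rank_eq_analyticRank_of_analyticRank_le_one) (hnf : exists_isNewformOf)
    (hPT : ∀ (K : Type) [Field K] [NumberField K], poitouTate_sum_localTatePairing_eq_zero K)
    (hEP : ∀ (K : Type) [Field K] [NumberField K] (v : HeightOneSpectrum (𝓞 K)),
      localEulerPoincareCharacteristic (v.adicCompletion K))
    (hD : P2.IMCDivIntFrameAtErratumDataBRamFree W p)
    [NeZero (W.conductorNorm ℤ)] {q : ℕ} [Fact q.Prime]
    (Dt : ModularParametrizationData W (W.conductorNorm ℤ))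
    (H : HeegnerDatum (W.conductorNorm ℤ) (NumberField.discr K)) (ιK : K →+* ℂ)
    {P : (W.baseChange K).toAffine.Point} (hp5 : 5 ≤ p) (hmult : Mult W p) (hsurj : Surj W p)
    (htors : ∀ P₀ : (W.baseChange ℚ_[p]).toAffine.Point, p • P₀ = 0 → P₀ = 0) (hr : W.analyticRank = 1)
    (hqp : q ≠ p) (hmq : Mult W q) (hns : ¬ W.HasSplitMultiplicativeReductionAtPrime q)
    (hK : IsErratumField W K q) (hCas : Cas20Standing K p (W.conductorNorm ℤ / p))
    (hP : WeierstrassCurve.Affine.Point.map ιK.toRatAlgHom P = heegnerPointComplex Dt H)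
    (hc : ¬ (p : ℤ) ∣ Dt.c) (hinf : ¬ IsOfFinAddOrder P) :
    2 * (padicValNat p (AddSubgroup.zmultiples P).index : ℤ) -
        padicValNat p (W.baseChange K).tamagawaProduct ≤
      (padicValNat p (Nat.card (AddCommGroup.primaryComponent (W.baseChange K).sha p)) : ℤ) := by
  obtain ⟨ι⟩ := PadicAlgCl.nonempty_ringEquiv_complex p
  have hirr : Irr W p := hasIrreducibleModPGaloisRep_of_hasSurjectiveModNGaloisRep W p hsurj
  have hp2 : p ≠ 2 := by omega
  have hq2 : q ≠ 2 := two_ne_of_isErratumField_of_cas20Standing W p K hK hCas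
  have hsplit : SplitsIn K p := hK.splitsIn_of_mult hmult (Ne.symm hqp)
  obtain ⟨κ, γ, 𝔭, hκ, hγ, h𝔭⟩ := exists_anticyclotomic_generator_prime (p := p) hK.1
  haveI : Fact (κ.IsTopGenerator γ) := ⟨hγ⟩
  obtain ⟨he, hf⟩ := degreeOne_of_splitsIn hK.1.1 hsplit h𝔭
  have hIW := imcLowerWaldspurgerOnTreeAt_of_frameBRamFree hGZK hnf hPT hEP ι hD Dt H ιK hp5 hmult hsurj
    htors hr hqp hmq hns hK hCas hP hc hinf hκ γ 𝔭 h𝔭 he hf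
  have hCTL := controlUpperOnTreeAt_of_isErratumField hGZK hnf hPT hEP hr hmult hirr hqp hK
    hinf hκ γ 𝔭 h𝔭 he hf
  have h := two_mul_index_le_of_onTreeUpperLinks hIW hCTL
  rw [padicValNat_tamagawaProductSplit_eq_of_isErratumField_nonsplit W p K hp2 hq2 hmq hns hK] at h
  omega

end Pointwise

end Summit.BirchSwinnertonDyer.BirchSwinnertonDyer.Theorems.RamFree

end
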